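import Literature.MathematicalPhysics.QuantumFieldTheory.Balaban1983to89.B2Ineq329BlockPoincare
import Literature.MathematicalPhysics.QuantumFieldTheory.Balaban1983to89.B2Prop31ZeroFieldConcrete

/-!
# `Balaban1983to89.B2Ineq329RegularField` — [Balaban1982Higgs2] (3.29) p. 590 FOR A REGULAR NON-ZERO VECTOR FIELD `Ã`
(= [Balaban1983RegularityDecay] *"Proposition 3.1′ of [2]"* (1.21)–(1.22)), PROVED ON THE CONCRETE (3.23)/(3.24)/(3.25)
CARRIER of the (Higgs)₂,₃ model, file 4/4: for every scale `k = j+1 ≤ K` (`Lᵏε ≤ 1`), every region `Λ_k`, every `Ã`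
which is `δ`-regular on `Ω = Bᵏ(Λ_k)` (`|Ã(⟨z+εe_ν,·⟩) − Ã(⟨z,·⟩)| ≤ δ`, (1.21) in lattice units) with the smallness
`8d⁴L^d e²(Lᵏε)²(Lᵏδ)² ≤ ½` (*"for e sufficiently small"*), every `γ₀ ≥ 0` with `γ₀(8d + 2m² + 4) ≤ a(1 − L⁻²)`,
`γ₀ ≤ 1/16` (e.g. `γ₀ = min(a(1 − L⁻²)/(8d + 2m² + 4), 1/16)`, `gamma0_regular_spec`), and EVERY `ψ : Λ_k → ℝ^N`,
`γ₀(Σ_{⟨y,y′⟩⊂Λ_k}(Lᵏε)^{d−2}|U(Ã(⟨y,y′⟩))ψ(y′) − ψ(y)|² + Σ_{y∈Λ_k}(Lᵏε)^d m²|ψ(y)|²) − 64γ₀d³e²(Lᵏδ)² Σ_{y∈Λ_k}(Lᵏε)^d|ψ(y)|²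
 ≤ ⟨ψ, Δ^{(k),Lᵏε}(Bᵏ(Λ_k), Ã)ψ⟩ = termForm R C a Ã m² j ψ` (`ineq329_regular_concrete`, the (1.22) shape: error
`O(1)e²(…)Σ_{Ω⁽ᵏ⁾}|φ|²`), pointwise in the fluctuation field (`sum329_le_pieceExp_regular`); and **Proposition 3.1 (3.26),
restricted clause**, for `⟨Φ, Δ(Ã^ε)Φ⟩ = form325 R C a Ã m² Φ` and every configuration `Φ` obeying sup-restrictions
`|φ_k| ≤ Ψ_k` on `Λ_k`, with the error `Σ_k 64γ₀d³e²(Lᵏδ_k)²Ψ_k²(Lᵏε)^d|Λ_k|` of the printed shape `Σ_k O(·)|Λ_k|`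
(`prop31_regular_concrete`; the printed reduction `B2Eq328ConcretePieces.prop31_concrete` generalised to restricted
configurations, `prop31_restricted_concrete`, with its per-scale input (3.29) DISCHARGED)

statement-level skeleton of published theorems with citation tags; proofs where landed; nothing here is a claim about the Yang–Mills mass gap

CITATION HEADER.  T. Bałaban, *(Higgs)₂,₃ quantum fields in a finite volume. II. An upper bound*, Commun. Math. Phys. **86**
(1982) 555–594 [Balaban1982Higgs2] (cell paper B2; PDF held `paper:balaban1982-cmp86-higgs23-ii`, journal page = PDF page
+ 554; Prop. 3.1 (3.26) p. 589 and (3.27)–(3.29) pp. 589–590 [PDF 35–36] READ AS IMAGES on the ×2 renders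
`run/shared/lean/pub/pub-balaban/b2b-balaban-ref1/pages/1982-cmp86-higgs23-II/1982-cmp86-higgs23-II-p035-x2.png`, `-p036-x2.png`);
T. Bałaban, *Regularity and decay of lattice Green's functions*, Commun. Math. Phys. **89** (1983) 571–597
[Balaban1983RegularityDecay] (= [B4]; `paper:balaban1983-cmp89-regularity-decay`, journal page = PDF page + 570; (1.21)–(1.22)
p. 574 [PDF 4] and §4 (4.1)–(4.9) pp. 589–590 [PDF 19–20] read on the ×2 renders `…/1983-cmp89-regularity-decay/…-p004/p019/p020-x2.png`);
part I [Balaban1982Higgs1], (1.7) p. 605, (2.11) p. 609, (2.15) p. 609 (`a_k ↘ a(1 − L⁻²)`), (2.17)–(2.19) p. 610.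
Cell `lit-balaban` (HOME `run/shared/lean/pub/lit-balaban/`), Phase-2 proof seat **p23** gen 9 (unit `lit-balaban-p23-g9`), files
1–3 of the same target: `B2Ineq329PrismHolonomy` (p303814), `B2Ineq329CovariantAveraging` (p304278), `B2Ineq329BlockPoincare`
(p305069).  SKELETON rows **B2.Eq3.29** ((3.27)–(3.29); decl of record `B2.Ineq329Printed`) and **B2.Prop3.1** (`B2.Prop31Printed`);
owner r02, second reader r14, referee ref-4; their last residue = cell GAPS **G-pv07-1** ((3.29) for a RESTRICTED `Ã ≠ 0`).
RELATED, BY NAME, NOT RESTATED: p15's zero-field clause `B2Prop31ZeroFieldConcrete.{ineq329_zero_concrete, prop31_zeroField_concrete}`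
(this carrier, `Ã = 0`, no error term), r14's `B2Prop31ZeroField` (ℤ^{d+1} carriers), p35's `B4Prop31Regular.form122_lattice`
([B4] (1.22) on the ℤ^{d+1} carriers `fineDom`, whose regions do not transport to torus regions that wrap — the reason
for this torus-side proof), b2b's dictionary `B2.ineq329_of_prop31Printed`.

WHAT IS PRINTED.  [B2] p. 589 [PDF 35]: *"**Proposition 3.1.** There exists a constant γ₀ > 0 dependent on the space dimension
d and the constant a only, and independent of ε and a choice of the sets Λ₅⁽⁰⁾, …, Λ₅⁽ᴷ⁻¹⁾, such that for arbitrary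
configurations Ã^ε, Φ defined by the formulas (3.2), (3.3), (3.24), and satisfying the restrictions given by the
characteristic functions in (3.21), the following inequality holds ⟨Φ, Δ(Ã^ε)Φ⟩ ≥ γ₀ Σ_{k=0}^{K} Σ_{⟨x,x′⟩⊂Λ₅⁽ᵏ⁻¹⁾′∩Λ₅⁽ᵏ⁾ᶜ}
(Lᵏε)^{d−2}|U(Ã^ε(⟨x,x′⟩))φ_k(x′) − φ_k(x)|² + γ₀ Σ_{k=0}^{K} Σ_{x∈Λ₅⁽ᵏ⁻¹⁾′∩Λ₅⁽ᵏ⁾ᶜ} (Lᵏε)^d m²|φ_k(x)|² − Σ_{k=1}^{K}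
O((Lᵏε)^{κ₀})|(Λ₅⁽ᵏ⁻¹⁾′∩Λ₅⁽ᵏ⁾ᶜ)₁|, (3.26) with κ₀ > 0. … We assume m² ≤ O(1) also."*; p. 590 [PDF 36]: *"Now inequality (3.26)
of the proposition follows from ⟨φ′_k, Δ⁽ᵏ⁾(Bᵏ(Λ_k), Ã^η)φ′_k⟩ ≥ γ₀(Σ_{⟨x,x′⟩⊂Λ_k} |U(Ã^η(⟨x,x′⟩))φ′_k(x′) − φ′_k(x)|² +
Σ_{x∈Λ_k} m²(Lᵏε)²|φ′_k(x)|²) − O((Lᵏε)^{κ₀})|Λ_k|, (3.29) with a constant γ₀ independent of k, Λ_k and for φ′_k, Ã^η satisfying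
suitable restrictions. This inequality will be proved together with the properties of the covariances"*.  [B4] p. 574 [PDF 4]:
*"Proposition 3.1′ of [2]. Let Ω be a sum of unit blocks (i.e. Ω⁽ᵏ⁾ is an arbitrary subset of Zᵈ) and let A satisfies the
condition |(∂^η_μA)(x)| ≤ O(1)p(e) (p(e) = a₀(1 + log e⁻¹)ᵖ), (1.21) then there exists a positive constant γ₀ depending on d
only, such that for e sufficiently small ⟨φ, Δ⁽ᵏ⁾(Ω,A)φ⟩ ≥ γ₀(Σ_{⟨x,x′⟩⊂Ω⁽ᵏ⁾}|U(A(⟨x,x′⟩))φ(x′) − φ(x)|² + m²Σ_{x∈Ω⁽ᵏ⁾}|φ(x)|²)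
− O(1)e^{2−α}Σ_{x∈Ω⁽ᵏ⁾}|φ(x)|² (1.22) … This theorem implies (3.29) of [2]."*; p. 589 [PDF 19]: *"In this integral we make
the gauge transformation φ′(x′) = U(A(Γ^{(k)}_{x′,x}))φ″(x′), and we integrate over the subspace orthogonal to the constant
functions on Bᵏ(x). … (the left hand side of (1.18)) ≥ Σ_{x∈Ω⁽ᵏ⁾} a_km²/(a_k + m²)|φ(x)|² ≥ a_k/(a_k + O(1)) Σ_{x∈Ω⁽ᵏ⁾}
m²|φ(x)|², (4.4) if m² ≤ O(1)."*; p. 590 [PDF 20]: *"Now it is easily seen that to prove (1.18) it is sufficient to prove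
a_k|φ(x)|² + a_k|φ(x′)|² − a_k²⟨φ, Q_k(A)G_k(Δ(x,x′),A)Q_k^*(A)φ⟩ ≥ γ₀′|U(A(⟨x,x′⟩))φ(x′) − φ(x)|² − O(1)e²p²(e)(|φ(x)|² +
|φ(x′)|²), (4.7) … Using the regularity condition for A, we write A = A₀ + A′ on Δ(x,x′) with A₀ constant and A′
satisfying the bounds |A′|, |∂^η_μA′| ≤ O(1)p(e). We expand … and we separate terms of first order in e."*

DICTIONARY (print ↦ Lean).  `⟨φ′_k, Δ⁽ᵏ⁾(Bᵏ(Λ_k), Ã^η)φ′_k⟩` ↦ `B2Eq328ConcretePieces.termForm R C a Ã m² j ψ` (`k = j+1`; the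
fibre minimum of the (I.2.19) exponent `pieceExp`, = `⟨ψ̃, Δ^{(k)}(Ω, Ã)ψ̃⟩` of (I.2.21) by `B2Eq328DeltaK.termForm_eq_deltaKA`;
NO rescaling to the unit lattice is performed, exactly as in p15's zero-field file); the k-th bond sum of (3.26) at `Ã`
↦ `Σ_{c⊂Λ_k}(Lᵏε)^d|(D^{Lᵏε}_{Ā⁽ᵏ⁾}ψ̃)(c)|²` with the coarse bond variable `Lᵏε Ā⁽ᵏ⁾(⟨y,y′⟩) = ε Σ_{⟨x,x′⟩⊂⟨y,y′⟩} Ã_{⟨x,x′⟩}`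
((II.2.55), p33's `B2Eq255Concrete.barA`; = the printed `Σ(Lᵏε)^{d−2}|U(Ã(⟨y,y′⟩))ψ̃(y′) − ψ̃(y)|²`, `bondKA_eq_sum_printed`); the
mass sum ↦ p15's `massK`; «A regular, (1.21)» ↦ `|Ã ⟨z+εe_ν, μ′⟩ − Ã ⟨z, μ′⟩| ≤ δ` on `Ω` (the lattice-units form; the
rescaled (1.21) reads `(Lᵏε)(Lᵏδ) ≤ O(1)p(e)`); «e sufficiently small» ↦ `8d⁴L^d e²(Lᵏε)²(Lᵏδ)² ≤ ½`; the printed error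
`O(1)e^{2−α}Σ_{Ω⁽ᵏ⁾}|φ|²` ↦ `64γ₀d³e²(Lᵏδ)² Σ_{y∈Λ_k}(Lᵏε)^d|ψ(y)|²` (`= O(1)e²p²(e)·Σ_{Λ_k}|φ′_k|²` under the rescaled
(1.21); the sharpening `e² ↦ e^{2−α}` of [B4] is not needed for (3.29) and not proved); «restrictions given by the
characteristic functions in (3.21)» ↦ the sup-restriction `|φ_k(y)| ≤ Ψ_k` on `Λ_k`, under which the error is
`≤ 64γ₀d³e²(Lᵏδ_k)²Ψ_k²(Lᵏε)^d|Λ_k|` (`l2_le_of_sup`) = the printed `O(·)|Λ_k|` shape (the identification of the constant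
with `O((Lᵏε)^{κ₀})` is b2b's dictionary `B2.ineq329_of_prop31Printed`, hypothesis `hAbs` there, not repeated here).
MECHANISM (pointwise in the fluctuation field `v`, as in p15's zero-field proof; `pieceExp = a_k(Lᵏε)⁻²T₁ + T₂ + m²T₃`,
`pieceExp_eq`): `ψ̃ = u + w`, `w = Q_k(Ã)ṽ`; bond sum `≤ 2E(u) + 2E(w)`, `E(u) ≤ 4d(Lᵏε)⁻²T₁` (`cov_bondSum_le_siteSum`,
unitarity), `E(w) ≤ 4T₂ + 8d³e²L^{2k}δ²T₃` (file 2's `cov_averaging_ineq` — the printed expansion in `A′` replaced by the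
exact prism decomposition); mass sum `≤ 2m²T₁ + 2m²T₃` by covariant Jensen (`cov_jensen_sum` — the printed gauge
transformation `φ′ = U(A(Γ^{(k)}))φ″` of (4.2)–(4.3)); the holonomy error `∝ T₃` is converted by file 3's `block_poincare`
(`T₃ ≤ 2Σ_{Λ_k}(Lᵏε)^d|w|² + 8dL^d(Lᵏε)²T₂` under the smallness) and `|w|² ≤ 2|ψ − w|² + 2|ψ|²` into `T₁`, `T₂` (absorbed)
and `Σ(Lᵏε)^d|ψ|²` (the printed error); `γ₀(8d + 2m² + 4) ≤ a(1 − L⁻²) < a_k` ((I.2.15), `B1.ainf_lt_aSeq`) closes.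

WHAT THIS MODULE PROVES (kernel-checked, 0 `sorry`, standard axioms; theorems only, no new definition, no `Prop` fact).
 §1 `pieceExp_eq` (general `Ã`), `cov_jensen_block`/`cov_jensen_sum`, `covBondSummand_eq`, `cov_bondSum_le_siteSum`,
    `bondKA_eq_sum_printed`, `covDeriv_add_field`.
 §2 **`sum329_le_pieceExp_regular`** (∀ v), **`ineq329_regular_concrete`** ((3.29)/(1.22) for `termForm`),
    `ineq329_regular_deltaKA` (for the solved (I.2.21) operator), `gamma0_regular_spec` (an admissible printed-type `γ₀ > 0`).
 §3 `prop31_restricted_concrete` (the printed reduction for restricted configurations), `l2_le_of_sup`,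
    **`prop31_regular_concrete`** (Prop. 3.1 (3.26), restricted clause, `h329` discharged), `prop31_regular_tower` (printed
    regions `Λ_k = Λ₅⁽ᵏ⁻¹⁾′∩Λ₅⁽ᵏ⁾ᶜ` of a `B2Eq324NestedRegions.Tower`).
HONEST SCOPE.  (i) The regularity of `Ã` on `Bᵏ(Λ_k)` and the sup-restrictions on `φ_k` are HYPOTHESES standing for *"the
restrictions given by the characteristic functions in (3.21)"*; that (3.21)'s characteristic functions deliver them (with
`δ_k`, `Ψ_k` making the error `O((Lᵏε)^{κ₀})|Λ_k|`) is the bookkeeping of b2b's `ineq329_of_prop31Printed` and of rows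
B2.Eq3.21/3.31, not proved here.  (ii) Constants (`64d³`, `8d⁴L^d`, `8d + 2m² + 4`, `1/16`) are ours; [B4]'s `e^{2−α}`
improvement and its Green's-function route (4.5)–(4.22) are not formalised — the lineage's exact-telescoping route is.
(iii) `K ≤` the number of scales of the lattice family and `Lᴷε ≤ 1` (as in p15's zero-field clause); `m² ≥ 0` for (3.29),
`m² > 0` for (3.26) (the carrier's `form325`).  (iv) No `B2.Ineq329Printed`/`B4.Prop31Printed` family is inhabited here
(their literal quantifier shapes carry the (3.21)/p(e) dictionary of (i)); the rows' heads are the concrete theorems above.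
-/

noncomputable section

open MeasureTheory Finset Real
open scoped BigOperators ENNReal InnerProductSpace

namespace Literature.MathematicalPhysics.QuantumFieldTheory.Balaban1983to89.B2Ineq329RegularField

open Literature.MathematicalPhysics.QuantumFieldTheory.Balaban1983to89.HiggsLattice
open Literature.MathematicalPhysics.QuantumFieldTheory.Balaban1983to89.HiggsAveraging
open Literature.MathematicalPhysics.QuantumFieldTheory.Balaban1983to89.HiggsCovariance
open Literature.MathematicalPhysics.QuantumFieldTheory.Balaban1983to89.HiggsCovariancePos
open Literature.MathematicalPhysics.QuantumFieldTheory.Balaban1983to89.HiggsFluctMeasure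
open Literature.MathematicalPhysics.QuantumFieldTheory.Balaban1983to89.B1Eq230FluctCov
open Literature.MathematicalPhysics.QuantumFieldTheory.Balaban1983to89.B2Ineq338Diamagnetic
open Literature.MathematicalPhysics.QuantumFieldTheory.Balaban1983to89.B2Eq337ScalarIntegration
open Literature.MathematicalPhysics.QuantumFieldTheory.Balaban1983to89.B2Eq325ConcreteSchur
open Literature.MathematicalPhysics.QuantumFieldTheory.Balaban1983to89.B2Ineq327ConcreteNeumann
open Literature.MathematicalPhysics.QuantumFieldTheory.Balaban1983to89.B2Eq328ConcretePieces
open Literature.MathematicalPhysics.QuantumFieldTheory.Balaban1983to89.B2Eq328DeltaK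
open Literature.MathematicalPhysics.QuantumFieldTheory.Balaban1983to89.B2Eq324NestedRegions
open Literature.MathematicalPhysics.QuantumFieldTheory.Balaban1983to89.B2Ineq329ZeroAveraging
open Literature.MathematicalPhysics.QuantumFieldTheory.Balaban1983to89.B2Prop31ZeroFieldConcrete
open Literature.MathematicalPhysics.QuantumFieldTheory.Balaban1983to89.B2Restr216Lattice (norm_U_apply)
open Literature.MathematicalPhysics.QuantumFieldTheory.Balaban1983to89.B2Eq255Concrete (barA barA_apply)
open Literature.MathematicalPhysics.QuantumFieldTheory.Balaban1983to89.B1Eq353SupNorm (card_blockK)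
open Literature.MathematicalPhysics.QuantumFieldTheory.Balaban1983to89.B2Ineq329CovariantAveraging
open Literature.MathematicalPhysics.QuantumFieldTheory.Balaban1983to89.B2Ineq329BlockPoincare

variable {P : HiggsLattice.Params} {N K : ℕ}

/-! ## §1 The (I.2.19) exponent at a general `Ã`, decomposed; covariant Jensen; covariant site-to-bond -/

section Pieces

variable (R : Regions P K) (C : ChargeData N)

/-- **The (I.2.19) exponent at a general vector field `Ã`, decomposed**: `pieceExp ψ v = a_k(Lᵏε)⁻²·T₁ + T₂ + m²·T₃` with
`T₁ = Σ_{y∈Λ_k}(Lᵏε)^d|ψ(y) − (Q_k(Ã)ṽ)(y)|²`, `T₂ = Σ_{b⊂Ω}ε^d|(D^ε_Ã ṽ)(b)|²`, `T₃ = Σ_{x∈Ω}ε^d|v(x)|²` (`ṽ = extP v`,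
`Ω = Bᵏ(Λ_k)`). [cite: Balaban1982Higgs1, (2.19) p.610] [cite: Balaban1982Higgs2, (3.28) p.589] -/
theorem pieceExp_eq (a : ℝ) (A : HiggsLattice.VecField P 0) (msq : ℝ) (j : Fin K) (ψ : LSite R j → V N)
    (v : PSite R j → V N) :
    pieceExp R C a A msq j ψ v
      = B1.aSeq a P.L (j.val + 1) * (P.mesh (j.val + 1))⁻¹ ^ 2 *
          (∑ y : LSite R j, P.mesh (j.val + 1) ^ P.d * ‖ψ y - avgQk C A (j.val + 1) (extP R j v) y.val‖ ^ 2)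
        + (∑ b : HiggsLattice.PBond P 0, if Inside (pieceF R j) b then
            P.mesh 0 ^ P.d * ‖covDeriv C A (extP R j v) b‖ ^ 2 else 0)
        + msq * ∑ x : PSite R j, P.mesh 0 ^ P.d * ‖v x‖ ^ 2 := by
  unfold pieceExp
  rw [add_assoc]
  congr 1
  · rw [Finset.mul_sum]
    refine Finset.sum_congr rfl fun y _ => ?_
    rw [precAt_eq, coeff221_eq]
    ring
  · rw [← siteBilin_apply, delta0_apply, map_add, map_smul, siteBilin_apply, siteBilin_apply, smul_eq_mul,
      siteInner_covLaplacianN, siteInner_extP_self]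
    congr 1
    refine Finset.sum_congr rfl fun b _ => ?_
    split_ifs
    · rw [real_inner_self_eq_norm_sq]
    · rfl

/-- **COVARIANT JENSEN**: `(Lᵏε)^d |(Q_k(Ã)f)(y)|² ≤ Σ_{x∈Bᵏ(y)} ε^d |f(x)|²` — the transports `U(Ã(Γ^{(k)}_{y,x}))` are unitary,
`|Bᵏ(y)| = L^{kd}` (`k ≤ K`); the mass step (4.1)–(4.4) of [B4] uses exactly this. [cite: Balaban1983RegularityDecay, (4.1)–(4.4) p.589]
[cite: Balaban1982Higgs1, (2.11) p.609] -/
theorem cov_jensen_block {k : ℕ} (hk : k ≤ P.K) (A : HiggsLattice.VecField P 0) (f : ScalarField P 0 N)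
    (y : HiggsLattice.Site P k) :
    P.mesh k ^ P.d * ‖avgQk C A k f y‖ ^ 2 ≤ ∑ x ∈ blockK k y, P.mesh 0 ^ P.d * ‖f x‖ ^ 2 := by
  rw [avgQk_apply, norm_smul, mul_pow, Real.norm_eq_abs, mesh_pow_d]
  set Nn : ℝ := (P.L : ℝ) ^ (k * P.d) with hNn_def
  have hNn : 0 < Nn := pow_pos (by exact_mod_cast P.hL) _
  have hcard : ((blockK k y).card : ℝ) = Nn := by
    rw [card_blockK hk]; push_cast; rfl
  have hm0 : 0 ≤ P.mesh 0 ^ P.d := pow_nonneg (P.mesh_pos 0).le _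
  have h1 : ‖∑ x ∈ blockK k y, C.U (P.mesh 0) (multiContourSum A k x) (f x)‖ ^ 2
      ≤ Nn * ∑ x ∈ blockK k y, ‖f x‖ ^ 2 := by
    calc ‖∑ x ∈ blockK k y, C.U (P.mesh 0) (multiContourSum A k x) (f x)‖ ^ 2
        ≤ (∑ x ∈ blockK k y, ‖C.U (P.mesh 0) (multiContourSum A k x) (f x)‖) ^ 2 := by
          gcongr
          exact norm_sum_le _ _
      _ = (∑ x ∈ blockK k y, ‖f x‖) ^ 2 := by
          congr 1
          exact Finset.sum_congr rfl fun x _ => norm_U_apply C _ _ _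
      _ ≤ ((blockK k y).card : ℝ) * ∑ x ∈ blockK k y, ‖f x‖ ^ 2 := sq_sum_le_card_mul_sum_sq
      _ = Nn * ∑ x ∈ blockK k y, ‖f x‖ ^ 2 := by rw [hcard]
  rw [abs_of_pos (inv_pos.2 hNn)]
  calc Nn * P.mesh 0 ^ P.d * (Nn⁻¹ ^ 2 * ‖∑ x ∈ blockK k y, C.U (P.mesh 0) (multiContourSum A k x) (f x)‖ ^ 2)
      = (P.mesh 0 ^ P.d * Nn⁻¹) * ‖∑ x ∈ blockK k y, C.U (P.mesh 0) (multiContourSum A k x) (f x)‖ ^ 2 := by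
        field_simp
    _ ≤ (P.mesh 0 ^ P.d * Nn⁻¹) * (Nn * ∑ x ∈ blockK k y, ‖f x‖ ^ 2) :=
        mul_le_mul_of_nonneg_left h1 (mul_nonneg hm0 (inv_pos.2 hNn).le)
    _ = ∑ x ∈ blockK k y, P.mesh 0 ^ P.d * ‖f x‖ ^ 2 := by
        rw [Finset.mul_sum, Finset.mul_sum]
        refine Finset.sum_congr rfl fun x _ => ?_
        field_simp

/-- **COVARIANT JENSEN, summed over a region**: `Σ_{y∈Λ}(Lᵏε)^d|(Q_k(Ã)f)(y)|² ≤ Σ_{x∈Bᵏ(Λ)} ε^d|f(x)|²`.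
[cite: Balaban1983RegularityDecay, (4.1)–(4.4) p.589] -/
theorem cov_jensen_sum {k : ℕ} (hk : k ≤ P.K) (A : HiggsLattice.VecField P 0) (Λ : Finset (HiggsLattice.Site P k))
    (Ω : Finset (HiggsLattice.Site P 0)) (hΩ : ∀ x, x ∈ Ω ↔ blockIter k x ∈ Λ) (f : ScalarField P 0 N) :
    ∑ y ∈ Λ, P.mesh k ^ P.d * ‖avgQk C A k f y‖ ^ 2 ≤ ∑ x ∈ Ω, P.mesh 0 ^ P.d * ‖f x‖ ^ 2 := by
  rw [← sum_blockK_sum Λ Ω hΩ]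
  exact Finset.sum_le_sum fun y _ => cov_jensen_block C hk A f y

/-- Each summand of the covariant bond form is the printed `η^{d−2}|U(A(⟨x,x′⟩))f(x′) − f(x)|²`. [cite: Balaban1982Higgs2, Prop. 3.1 (3.26) p.589] -/
theorem covBondSummand_eq {k : ℕ} (B : HiggsLattice.VecField P k) (f : ScalarField P k N) (b : HiggsLattice.PBond P k) :
    P.mesh k ^ P.d * ‖covDeriv C B f b‖ ^ 2
      = P.mesh k ^ P.d * (P.mesh k)⁻¹ ^ 2 * ‖C.U (P.mesh k) (B b) (f b.tgt) - f b.src‖ ^ 2 := by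
  unfold HiggsLattice.covDeriv
  rw [norm_smul, mul_pow, Real.norm_eq_abs, abs_of_pos (inv_pos.2 (P.mesh_pos k))]
  ring

/-- **COVARIANT SITE-TO-BOND**: `Σ_{⟨y,y′⟩⊂Λ} η^d|(D^η_B f)|² ≤ 4d·η⁻²·Σ_{y∈Λ} η^d|f(y)|²` (`|Uf(y′) − f(y)| ≤ |f(y′)| + |f(y)|`
by unitarity; every site begins `≤ d` and ends `≤ d` bonds) — p15's `bondSum_le_siteSum` with transports. [cite: Balaban1983RegularityDecay, (1.22) p.574] -/
theorem cov_bondSum_le_siteSum {k : ℕ} (Λ : Finset (HiggsLattice.Site P k)) (B : HiggsLattice.VecField P k)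
    (f : ScalarField P k N) :
    (∑ c : HiggsLattice.PBond P k, if Inside Λ c then P.mesh k ^ P.d * ‖covDeriv C B f c‖ ^ 2 else 0)
      ≤ 4 * P.d * (P.mesh k)⁻¹ ^ 2 * ∑ y ∈ Λ, P.mesh k ^ P.d * ‖f y‖ ^ 2 := by
  classical
  -- compare termwise with the zero-field bond sum of the MODULUS-free majorant: reduce to p15's counting
  set w : ℝ := P.mesh k ^ P.d * (P.mesh k)⁻¹ ^ 2 with hw
  have hw0 : 0 ≤ w := mul_nonneg (pow_nonneg (P.mesh_pos k).le _) (sq_nonneg _)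
  have hpt : ∀ c : HiggsLattice.PBond P k,
      (if Inside Λ c then P.mesh k ^ P.d * ‖covDeriv C B f c‖ ^ 2 else 0)
        ≤ 2 * w * (if c.src ∈ Λ then ‖f c.src‖ ^ 2 else 0) + 2 * w * (if c.tgt ∈ Λ then ‖f c.tgt‖ ^ 2 else 0) := by
    intro c
    by_cases hc : Inside Λ c
    · rw [if_pos hc, if_pos hc.1, if_pos hc.2, covBondSummand_eq]
      have h2 : ‖C.U (P.mesh k) (B c) (f c.tgt) - f c.src‖ ^ 2 ≤ 2 * ‖f c.src‖ ^ 2 + 2 * ‖f c.tgt‖ ^ 2 := by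
        have h := norm_sub_le (C.U (P.mesh k) (B c) (f c.tgt)) (f c.src)
        rw [norm_U_apply] at h
        have hsq : ‖C.U (P.mesh k) (B c) (f c.tgt) - f c.src‖ * ‖C.U (P.mesh k) (B c) (f c.tgt) - f c.src‖
            ≤ (‖f c.tgt‖ + ‖f c.src‖) * (‖f c.tgt‖ + ‖f c.src‖) := mul_le_mul h h (norm_nonneg _) (by positivity)
        nlinarith [hsq, sq_nonneg (‖f c.tgt‖ - ‖f c.src‖)]
      calc P.mesh k ^ P.d * (P.mesh k)⁻¹ ^ 2 * ‖C.U (P.mesh k) (B c) (f c.tgt) - f c.src‖ ^ 2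
          = w * ‖C.U (P.mesh k) (B c) (f c.tgt) - f c.src‖ ^ 2 := by rw [hw]
        _ ≤ w * (2 * ‖f c.src‖ ^ 2 + 2 * ‖f c.tgt‖ ^ 2) := mul_le_mul_of_nonneg_left h2 hw0
        _ = _ := by ring
    · rw [if_neg hc]
      have ha : 0 ≤ (if c.src ∈ Λ then ‖f c.src‖ ^ 2 else 0) := by split_ifs <;> positivity
      have hb : 0 ≤ (if c.tgt ∈ Λ then ‖f c.tgt‖ ^ 2 else 0) := by split_ifs <;> positivity
      positivity
  -- the two site sums (the count of p15's `bondSum_le_siteSum`)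
  have hsrc : ∑ c : HiggsLattice.PBond P k, (if c.src ∈ Λ then ‖f c.src‖ ^ 2 else 0)
      = P.d * ∑ y ∈ Λ, ‖f y‖ ^ 2 := by
    rw [← sum_site_dir (fun x (_ : Fin P.d) => if x ∈ Λ then ‖f x‖ ^ 2 else 0)]
    simp only [Finset.sum_const, Finset.card_univ, Fintype.card_fin, nsmul_eq_mul]
    rw [← Finset.mul_sum, ← Finset.sum_filter, Finset.filter_mem_eq_inter, Finset.univ_inter]
  have htgt : ∑ c : HiggsLattice.PBond P k, (if c.tgt ∈ Λ then ‖f c.tgt‖ ^ 2 else 0)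
      = P.d * ∑ y ∈ Λ, ‖f y‖ ^ 2 := by
    show (∑ c : HiggsLattice.PBond P k, (if c.src.shift c.dir ∈ Λ then ‖f (c.src.shift c.dir)‖ ^ 2 else 0)) = _
    rw [← sum_site_dir (fun x (μ : Fin P.d) => if x.shift μ ∈ Λ then ‖f (x.shift μ)‖ ^ 2 else 0)]
    rw [Finset.sum_comm]
    have hμ : ∀ μ : Fin P.d, ∑ x : HiggsLattice.Site P k, (if x.shift μ ∈ Λ then ‖f (x.shift μ)‖ ^ 2 else 0)
        = ∑ y ∈ Λ, ‖f y‖ ^ 2 := by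
      intro μ
      rw [show (∑ x : HiggsLattice.Site P k, (if x.shift μ ∈ Λ then ‖f (x.shift μ)‖ ^ 2 else 0))
          = ∑ x : HiggsLattice.Site P k, (fun y => if y ∈ Λ then ‖f y‖ ^ 2 else 0) (shiftEquiv P k μ x) from rfl,
        Equiv.sum_comp (shiftEquiv P k μ) (fun y => if y ∈ Λ then ‖f y‖ ^ 2 else 0),
        ← Finset.sum_filter, Finset.filter_mem_eq_inter, Finset.univ_inter]
    simp only [hμ, Finset.sum_const, Finset.card_univ, Fintype.card_fin, nsmul_eq_mul]
  calc (∑ c : HiggsLattice.PBond P k, if Inside Λ c then P.mesh k ^ P.d * ‖covDeriv C B f c‖ ^ 2 else 0)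
      ≤ ∑ c : HiggsLattice.PBond P k, (2 * w * (if c.src ∈ Λ then ‖f c.src‖ ^ 2 else 0)
          + 2 * w * (if c.tgt ∈ Λ then ‖f c.tgt‖ ^ 2 else 0)) := Finset.sum_le_sum fun c _ => hpt c
    _ = 2 * w * (P.d * ∑ y ∈ Λ, ‖f y‖ ^ 2) + 2 * w * (P.d * ∑ y ∈ Λ, ‖f y‖ ^ 2) := by
        rw [Finset.sum_add_distrib, ← Finset.mul_sum, ← Finset.mul_sum, hsrc, htgt]
    _ = 4 * P.d * (P.mesh k)⁻¹ ^ 2 * ∑ y ∈ Λ, P.mesh k ^ P.d * ‖f y‖ ^ 2 := by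
        rw [hw, ← Finset.mul_sum]
        ring

/-- **The printed form of the k-th bond sum of (3.26)/(3.29) at `Ã`**: with the coarse bond variable `Lᵏε·Ā⁽ᵏ⁾(⟨y,y′⟩) =
ε·Σ_{⟨x,x′⟩⊂⟨y,y′⟩}Ã_{⟨x,x′⟩}` ((II.2.55); `U_mesh_barA`), `Σ_{⟨y,y′⟩⊂Λ_k}(Lᵏε)^d|(D^{Lᵏε}_{Ā⁽ᵏ⁾}ψ̃)(⟨y,y′⟩)|² =
Σ_{⟨y,y′⟩⊂Λ_k}(Lᵏε)^{d−2}|U(Ã(⟨y,y′⟩))ψ̃(y′) − ψ̃(y)|²`. [cite: Balaban1982Higgs2, Prop. 3.1 (3.26) p.589, (3.29) p.590] -/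
theorem bondKA_eq_sum_printed {k : ℕ} (A : HiggsLattice.VecField P 0) (Λ : Finset (HiggsLattice.Site P k))
    (f : ScalarField P k N) :
    (∑ c : HiggsLattice.PBond P k, if Inside Λ c then P.mesh k ^ P.d * ‖covDeriv C (barA k A) f c‖ ^ 2 else 0)
      = ∑ c : HiggsLattice.PBond P k, if Inside Λ c then P.mesh k ^ P.d * (P.mesh k)⁻¹ ^ 2 *
          ‖C.U (P.mesh 0) (segSum A (toFinest c.src) c.dir (P.L ^ k)) (f c.tgt) - f c.src‖ ^ 2 else 0 := by
  refine Finset.sum_congr rfl fun c _ => ?_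
  split_ifs
  · rw [covBondSummand_eq, U_mesh_barA]
  · rfl

/-- The covariant derivative (I.1.7) is additive in the scalar field. [cite: Balaban1982Higgs1, (1.7) p.605] -/
theorem covDeriv_add_field {k : ℕ} (B : HiggsLattice.VecField P k) (f g : ScalarField P k N) (b : HiggsLattice.PBond P k) :
    covDeriv C B (f + g) b = covDeriv C B f b + covDeriv C B g b := by
  unfold HiggsLattice.covDeriv
  rw [Pi.add_apply, Pi.add_apply, map_add, ← smul_add]
  congr 1
  abel

end Pieces

/-! ## §2 (3.29) = [B4] (1.22) at a regular non-zero `Ã` on the concrete carrier, pointwise in the fluctuation field -/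

section Ineq329

variable (R : Regions P K) (C : ChargeData N) {a msq : ℝ}

/-- `c|a + b|² ≤ 2c|a|² + 2c|b|²` (`c ≥ 0`). [folklore] -/
private theorem sq_step_add {E : Type*} [SeminormedAddCommGroup E] (c : ℝ) (hc : 0 ≤ c) (a b : E) :
    c * ‖a + b‖ ^ 2 ≤ 2 * (c * ‖a‖ ^ 2) + 2 * (c * ‖b‖ ^ 2) := by
  have h := mul_le_mul_of_nonneg_left (norm_add_sq_le' a b) hc
  linarith

/-- `c m|ψ|² ≤ 2m·c|ψ − w|² + 2m·c|w|²` (`c, m ≥ 0`). [folklore] -/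
private theorem sq_step_mass {E : Type*} [SeminormedAddCommGroup E] (c m : ℝ) (hc : 0 ≤ c) (hm : 0 ≤ m) (ψ w : E) :
    c * m * ‖ψ‖ ^ 2 ≤ 2 * m * (c * ‖ψ - w‖ ^ 2) + 2 * m * (c * ‖w‖ ^ 2) := by
  have h0 := norm_add_sq_le' (ψ - w) w
  rw [sub_add_cancel] at h0
  have h := mul_le_mul_of_nonneg_left h0 (mul_nonneg hc hm)
  linarith

/-- `c|w|² ≤ 2c|ψ − w|² + 2c|ψ|²` (`c ≥ 0`). [folklore] -/
private theorem sq_step_w {E : Type*} [SeminormedAddCommGroup E] (c : ℝ) (hc : 0 ≤ c) (ψ w : E) :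
    c * ‖w‖ ^ 2 ≤ 2 * (c * ‖ψ - w‖ ^ 2) + 2 * (c * ‖ψ‖ ^ 2) := by
  have h0 := norm_add_sq_le' (w - ψ) ψ
  rw [sub_add_cancel, norm_sub_rev] at h0
  have h := mul_le_mul_of_nonneg_left h0 hc
  linarith

/-- **(3.29) AT A REGULAR `Ã ≠ 0`, POINTWISE IN THE FIBRE VARIABLE** (`k = j+1 ≤ K`, `Lᵏε ≤ 1`, `Ω = Bᵏ(Λ_k)`): if
`|Ã(⟨z+εe_ν,·⟩) − Ã(⟨z,·⟩)| ≤ δ` on `Ω` ((1.21) of [B4] in lattice units) and the smallness `8d⁴L^d e²(Lᵏε)²(Lᵏδ)² ≤ ½`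
holds (*"for e sufficiently small"*), then for every `γ₀ ≥ 0` with `γ₀(8d + 2m² + 4) ≤ a(1 − L⁻²)`, `γ₀ ≤ 1/16`, every
`ψ : Λ_k → ℝ^N` and EVERY `v`,
`γ₀(Σ_{⟨y,y′⟩⊂Λ_k}(Lᵏε)^d|(D^{Lᵏε}_{Ā⁽ᵏ⁾}ψ̃)|² + Σ_{y∈Λ_k}(Lᵏε)^d m²|ψ(y)|²) − 64γ₀d³e²(Lᵏδ)² Σ_{y∈Λ_k}(Lᵏε)^d|ψ(y)|² ≤ pieceExp ψ v`
— the shape of (1.22) (error `O(1)e²p²(e)Σ_{Ω⁽ᵏ⁾}|φ|²`) with [B4] §4's mass step (4.1)–(4.4) (covariant Jensen) and the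
lineage's bond step (exact covariant telescoping, `cov_averaging_ineq`), the holonomy error on the fluctuation field being
converted by `block_poincare`. [cite: Balaban1982Higgs2, (3.29) p.590] [cite: Balaban1983RegularityDecay, (1.21)–(1.22) p.574, (4.4)–(4.7) pp.589–590] -/
theorem sum329_le_pieceExp_regular (hK : K ≤ P.K) (ha : 0 < a) (hL : 1 < P.L) (hmsq : 0 ≤ msq)
    (A : HiggsLattice.VecField P 0) (j : Fin K) (hs : P.mesh (j.val + 1) ≤ 1) {δ : ℝ} (hδ : 0 ≤ δ)
    (hreg : ∀ z ∈ pieceF R j, ∀ μ' ν : Fin P.d, |A ⟨z.shift ν, μ'⟩ - A ⟨z, μ'⟩| ≤ δ)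
    (hsmall : 8 * (P.d : ℝ) ^ 4 * (P.L : ℝ) ^ P.d * C.e ^ 2 * P.mesh (j.val + 1) ^ 2 *
      ((P.L : ℝ) ^ (j.val + 1)) ^ 2 * δ ^ 2 ≤ 1 / 2)
    {γ₀ : ℝ} (hγ0 : 0 ≤ γ₀) (hγB : γ₀ * (8 * P.d + 2 * msq + 4) ≤ a * (1 - ((P.L : ℝ) ^ 2)⁻¹))
    (hγ16 : γ₀ ≤ 1 / 16) (ψ : LSite R j → V N) (v : PSite R j → V N) :
    γ₀ * ((∑ c : HiggsLattice.PBond P (j.val + 1), if Inside (R.block j) c then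
            P.mesh (j.val + 1) ^ P.d * ‖covDeriv C (barA (j.val + 1) A) (extL R j ψ) c‖ ^ 2 else 0)
          + massK R msq j ψ)
      - 64 * γ₀ * (P.d : ℝ) ^ 3 * C.e ^ 2 * ((P.L : ℝ) ^ (j.val + 1)) ^ 2 * δ ^ 2 *
          (∑ y : LSite R j, P.mesh (j.val + 1) ^ P.d * ‖ψ y‖ ^ 2)
      ≤ pieceExp R C a A msq j ψ v := by
  classical
  have hk : j.val + 1 ≤ P.K := le_trans (Nat.succ_le_of_lt j.isLt) hK
  have hL' : (1 : ℝ) < P.L := by exact_mod_cast hL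
  have hd1 : (1 : ℝ) ≤ P.d := by exact_mod_cast P.hd
  have hsd : 0 ≤ P.mesh (j.val + 1) ^ P.d := pow_nonneg (P.mesh_pos _).le _
  have hm0 : 0 ≤ P.mesh 0 ^ P.d := pow_nonneg (P.mesh_pos 0).le _
  -- ── the analytic inputs, in concrete terms ──
  -- (a) `ψ̃ = u + w`: the bond sum splits
  have ha1 : (∑ c : HiggsLattice.PBond P (j.val + 1), if Inside (R.block j) c then
          P.mesh (j.val + 1) ^ P.d * ‖covDeriv C (barA (j.val + 1) A) (extL R j ψ) c‖ ^ 2 else 0)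
      ≤ 2 * (∑ c : HiggsLattice.PBond P (j.val + 1), if Inside (R.block j) c then
          P.mesh (j.val + 1) ^ P.d * ‖covDeriv C (barA (j.val + 1) A)
            (extL R j ψ - avgQk C A (j.val + 1) (extP R j v)) c‖ ^ 2 else 0)
        + 2 * (∑ c : HiggsLattice.PBond P (j.val + 1), if Inside (R.block j) c then
          P.mesh (j.val + 1) ^ P.d * ‖covDeriv C (barA (j.val + 1) A)
            (avgQk C A (j.val + 1) (extP R j v)) c‖ ^ 2 else 0) := by
    rw [Finset.mul_sum, Finset.mul_sum, ← Finset.sum_add_distrib]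
    refine Finset.sum_le_sum fun c _ => ?_
    split_ifs
    · have hd : covDeriv C (barA (j.val + 1) A) (extL R j ψ) c
          = covDeriv C (barA (j.val + 1) A) (extL R j ψ - avgQk C A (j.val + 1) (extP R j v)) c
            + covDeriv C (barA (j.val + 1) A) (avgQk C A (j.val + 1) (extP R j v)) c := by
        rw [← covDeriv_add_field C, sub_add_cancel]
      rw [hd]
      exact sq_step_add _ hsd _ _
    · simp
  -- (b) covariant site-to-bond for `u`
  have hb1 := cov_bondSum_le_siteSum C (R.block j) (barA (j.val + 1) A)
    (extL R j ψ - avgQk C A (j.val + 1) (extP R j v))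
  have hT1' : ∑ y ∈ R.block j, P.mesh (j.val + 1) ^ P.d *
        ‖(extL R j ψ - avgQk C A (j.val + 1) (extP R j v)) y‖ ^ 2
      = ∑ y : LSite R j, P.mesh (j.val + 1) ^ P.d * ‖ψ y - avgQk C A (j.val + 1) (extP R j v) y.val‖ ^ 2 := by
    rw [← Finset.sum_coe_sort (R.block j)]
    refine Finset.sum_congr rfl fun y _ => ?_
    rw [Pi.sub_apply, extL_apply_of R j ψ y.prop]
  rw [hT1'] at hb1
  -- (c) the covariant averaging inequality for `w` (file 2)
  have hc1 := cov_averaging_ineq hk C A (R.block j) (pieceF R j) (mem_pieceF_iff R j) hδ hreg (extP R j v)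
  have hRt : ∑ x ∈ pieceF R j, P.mesh 0 ^ P.d * ‖extP R j v x‖ ^ 2 = ∑ x : PSite R j, P.mesh 0 ^ P.d * ‖v x‖ ^ 2 := by
    rw [Finset.sum_subtype (pieceF R j) (mem_pieceF R j)]
    refine Finset.sum_congr rfl fun x _ => ?_
    rw [extP_apply_of R j v x.prop]
  rw [hRt] at hc1
  -- (d) the mass sum against `T₁` and the block averages
  have hd1' : massK R msq j ψ ≤ 2 * msq * (∑ y : LSite R j, P.mesh (j.val + 1) ^ P.d *
        ‖ψ y - avgQk C A (j.val + 1) (extP R j v) y.val‖ ^ 2)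
      + 2 * msq * (∑ y ∈ R.block j, P.mesh (j.val + 1) ^ P.d * ‖avgQk C A (j.val + 1) (extP R j v) y‖ ^ 2) := by
    rw [massK, ← Finset.sum_coe_sort (R.block j), Finset.mul_sum, Finset.mul_sum, ← Finset.sum_add_distrib]
    exact Finset.sum_le_sum fun y _ => sq_step_mass _ _ hsd hmsq _ _
  -- (e) covariant Jensen (the mass step (4.1)–(4.4))
  have he1 := cov_jensen_sum C hk A (R.block j) (pieceF R j) (mem_pieceF_iff R j) (extP R j v)
  rw [hRt] at he1
  -- (f) block Poincaré (file 3)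
  have hf1 := block_poincare hk C A (R.block j) (pieceF R j) (mem_pieceF_iff R j) hδ hreg (extP R j v)
  rw [hRt] at hf1
  -- (g) `|w|² ≤ 2|ψ − w|² + 2|ψ|²` on `Λ_k`
  have hg1 : ∑ y ∈ R.block j, P.mesh (j.val + 1) ^ P.d * ‖avgQk C A (j.val + 1) (extP R j v) y‖ ^ 2
      ≤ 2 * (∑ y : LSite R j, P.mesh (j.val + 1) ^ P.d * ‖ψ y - avgQk C A (j.val + 1) (extP R j v) y.val‖ ^ 2)
        + 2 * (∑ y : LSite R j, P.mesh (j.val + 1) ^ P.d * ‖ψ y‖ ^ 2) := by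
    rw [← Finset.sum_coe_sort (R.block j), Finset.mul_sum, Finset.mul_sum, ← Finset.sum_add_distrib]
    exact Finset.sum_le_sum fun y _ => sq_step_w _ hsd _ _
  -- (h) the (I.2.19) exponent, decomposed
  have hE := pieceExp_eq R C a A msq j ψ v
  clear hT1' hRt hreg
  -- ── abstraction of the atoms ──
  set s := P.mesh (j.val + 1) with hs_def
  set n : ℝ := (P.L : ℝ) ^ (j.val + 1) with hn
  set w := avgQk C A (j.val + 1) (extP R j v) with hw
  set T1 := ∑ y : LSite R j, s ^ P.d * ‖ψ y - w y.val‖ ^ 2 with hT1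
  set T2 := ∑ b : HiggsLattice.PBond P 0, if Inside (pieceF R j) b then
    P.mesh 0 ^ P.d * ‖covDeriv C A (extP R j v) b‖ ^ 2 else 0 with hT2
  set T3 := ∑ x : PSite R j, P.mesh 0 ^ P.d * ‖v x‖ ^ 2 with hT3
  set Mψ := ∑ y : LSite R j, s ^ P.d * ‖ψ y‖ ^ 2 with hMψ
  set Mw := ∑ y ∈ R.block j, s ^ P.d * ‖w y‖ ^ 2 with hMw
  set Eu := ∑ c : HiggsLattice.PBond P (j.val + 1), if Inside (R.block j) c then
    s ^ P.d * ‖covDeriv C (barA (j.val + 1) A) (extL R j ψ - w) c‖ ^ 2 else 0 with hEu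
  set Ew := ∑ c : HiggsLattice.PBond P (j.val + 1), if Inside (R.block j) c then
    s ^ P.d * ‖covDeriv C (barA (j.val + 1) A) w c‖ ^ 2 else 0 with hEw
  set BKA := ∑ c : HiggsLattice.PBond P (j.val + 1), if Inside (R.block j) c then
    s ^ P.d * ‖covDeriv C (barA (j.val + 1) A) (extL R j ψ) c‖ ^ 2 else 0 with hBKA
  set ak := B1.aSeq a P.L (j.val + 1) with hak
  clear_value s n w T1 T2 T3 Mψ Mw Eu Ew BKA ak
  -- ── arithmetic ──
  have hs0 : 0 < s := by rw [hs_def]; exact P.mesh_pos _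
  have hT1_0 : 0 ≤ T1 := by rw [hT1]; exact Finset.sum_nonneg fun y _ => mul_nonneg hsd (sq_nonneg _)
  have hT2_0 : 0 ≤ T2 := by
    rw [hT2]
    refine Finset.sum_nonneg fun b _ => ?_
    split_ifs
    · exact mul_nonneg hm0 (sq_nonneg _)
    · exact le_rfl
  have hT3_0 : 0 ≤ T3 := by rw [hT3]; exact Finset.sum_nonneg fun x _ => mul_nonneg hm0 (sq_nonneg _)
  have hMψ0 : 0 ≤ Mψ := by rw [hMψ]; exact Finset.sum_nonneg fun y _ => mul_nonneg hsd (sq_nonneg _)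
  have hMw0 : 0 ≤ Mw := by rw [hMw]; exact Finset.sum_nonneg fun y _ => mul_nonneg hsd (sq_nonneg _)
  set H : ℝ := 8 * (P.d : ℝ) ^ 3 * C.e ^ 2 * n ^ 2 * δ ^ 2 with hH
  set σ : ℝ := 8 * (P.d : ℝ) ^ 4 * (P.L : ℝ) ^ P.d * C.e ^ 2 * s ^ 2 * n ^ 2 * δ ^ 2 with hσ
  set Y := s⁻¹ ^ 2 * T1 with hY
  have hH0 : 0 ≤ H := by rw [hH]; positivity
  have hσH : σ = (P.d : ℝ) * (P.L : ℝ) ^ P.d * s ^ 2 * H := by rw [hσ, hH]; ring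
  have hdL : (1 : ℝ) ≤ (P.d : ℝ) * (P.L : ℝ) ^ P.d :=
    one_le_mul_of_one_le_of_one_le hd1 (one_le_pow₀ hL'.le)
  have hHs : H * s ^ 2 ≤ σ := by
    rw [hσH]
    have h0 : 0 ≤ s ^ 2 * H := mul_nonneg (sq_nonneg _) hH0
    calc H * s ^ 2 = 1 * (s ^ 2 * H) := by ring
      _ ≤ ((P.d : ℝ) * (P.L : ℝ) ^ P.d) * (s ^ 2 * H) := mul_le_mul_of_nonneg_right hdL h0
      _ = (P.d : ℝ) * (P.L : ℝ) ^ P.d * s ^ 2 * H := by ring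
  have hσ12 : σ ≤ 1 / 2 := hsmall
  have hY0 : 0 ≤ Y := mul_nonneg (sq_nonneg _) hT1_0
  have hT1Y : T1 = s ^ 2 * Y := by rw [hY]; field_simp
  have hs1 : s ^ 2 ≤ 1 := pow_le_one₀ hs0.le hs
  have hT1le : T1 ≤ Y := by
    rw [hT1Y]
    calc s ^ 2 * Y ≤ 1 * Y := mul_le_mul_of_nonneg_right hs1 hY0
      _ = Y := one_mul Y
  -- (F1) the bond sum
  have hF1 : BKA ≤ 8 * P.d * Y + 8 * T2 + 2 * (H * T3) := by
    have e2 : 4 * (P.d : ℝ) * s⁻¹ ^ 2 * T1 = 4 * P.d * Y := by rw [hY]; ring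
    have e3 : 8 * (P.d : ℝ) ^ 3 * C.e ^ 2 * n ^ 2 * δ ^ 2 * T3 = H * T3 := by rw [hH]
    rw [e2] at hb1
    rw [e3] at hc1
    linarith only [ha1, hb1, hc1]
  -- (F2) the mass sum
  have hF2 : massK R msq j ψ ≤ 2 * (msq * T1) + 2 * (msq * T3) := by
    have hh := mul_le_mul_of_nonneg_left he1 hmsq
    linarith only [hd1', hh]
  -- (F3) block Poincaré and the smallness: `T3 ≤ 2Mw + 8dL^d s² T2`
  have hF3 : T3 ≤ 2 * Mw + 8 * P.d * (P.L : ℝ) ^ P.d * s ^ 2 * T2 := by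
    have e : 8 * (P.d : ℝ) ^ 4 * (P.L : ℝ) ^ P.d * C.e ^ 2 * s ^ 2 * n ^ 2 * δ ^ 2 * T3 = σ * T3 := by rw [hσ]
    rw [e] at hf1
    have hσT : σ * T3 ≤ 1 / 2 * T3 := mul_le_mul_of_nonneg_right hσ12 hT3_0
    linarith only [hf1, hσT]
  -- (F4) = (g); (F5) the holonomy error on the fluctuation field in terms of `Y`, `T2`, `Mψ`
  have hF5 : H * T3 ≤ 2 * Y + 4 * (H * Mψ) + 4 * T2 := by
    have h1 : H * T3 ≤ H * (2 * Mw + 8 * P.d * (P.L : ℝ) ^ P.d * s ^ 2 * T2) := mul_le_mul_of_nonneg_left hF3 hH0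
    have h2 : H * Mw ≤ H * (2 * T1 + 2 * Mψ) := mul_le_mul_of_nonneg_left hg1 hH0
    have h3 : H * (8 * P.d * (P.L : ℝ) ^ P.d * s ^ 2 * T2) = 8 * (σ * T2) := by rw [hσH]; ring
    have h4 : σ * T2 ≤ 1 / 2 * T2 := mul_le_mul_of_nonneg_right hσ12 hT2_0
    have h5 : H * T1 = (H * s ^ 2) * Y := by rw [hT1Y]; ring
    have h6 : H * T1 ≤ 1 / 2 * Y := by
      rw [h5]
      exact mul_le_mul_of_nonneg_right (hHs.trans hσ12) hY0
    linarith only [h1, h2, h3, h4, h6, hT2_0]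
  -- assemble
  have hsum : BKA + massK R msq j ψ ≤ (8 * P.d + 2 * msq + 4) * Y + 16 * T2 + 2 * (msq * T3) + 8 * (H * Mψ) := by
    have h2 : msq * T1 ≤ msq * Y := mul_le_mul_of_nonneg_left hT1le hmsq
    linarith only [hF1, hF2, hF5, h2]
  set ainf : ℝ := a * (1 - ((P.L : ℝ) ^ 2)⁻¹) with hainf
  have hak_gt : ainf < ak := by rw [hak]; exact B1.ainf_lt_aSeq ha hL' (j.val + 1) (Nat.le_add_left 1 _)
  have herr : 64 * γ₀ * (P.d : ℝ) ^ 3 * C.e ^ 2 * n ^ 2 * δ ^ 2 * Mψ = 8 * γ₀ * (H * Mψ) := by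
    rw [hH]; ring
  rw [herr]
  calc γ₀ * (BKA + massK R msq j ψ) - 8 * γ₀ * (H * Mψ)
      ≤ γ₀ * ((8 * P.d + 2 * msq + 4) * Y + 16 * T2 + 2 * (msq * T3) + 8 * (H * Mψ)) - 8 * γ₀ * (H * Mψ) := by
        linarith only [mul_le_mul_of_nonneg_left hsum hγ0]
    _ = (γ₀ * (8 * P.d + 2 * msq + 4)) * Y + (16 * γ₀) * T2 + (2 * γ₀) * (msq * T3) := by ring
    _ ≤ ak * Y + 1 * T2 + 1 * (msq * T3) := by
        refine add_le_add (add_le_add ?_ ?_) ?_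
        · exact mul_le_mul_of_nonneg_right (hγB.trans hak_gt.le) hY0
        · exact mul_le_mul_of_nonneg_right (by linarith only [hγ16]) hT2_0
        · exact mul_le_mul_of_nonneg_right (by linarith only [hγ16]) (mul_nonneg hmsq hT3_0)
    _ = pieceExp R C a A msq j ψ v := by rw [hE, hY]; ring


/-- **(3.29) = [B4] (1.22) AT A REGULAR `Ã ≠ 0` ON THE CONCRETE CARRIER** (`k = j+1 ≤ K`, `Lᵏε ≤ 1`; `Ã` with
`|Ã(⟨z+εe_ν,·⟩) − Ã(⟨z,·⟩)| ≤ δ` on `Bᵏ(Λ_k)`, `8d⁴L^d e²(Lᵏε)²(Lᵏδ)² ≤ ½`): for every `γ₀ ≥ 0` with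
`γ₀(8d + 2m² + 4) ≤ a(1 − L⁻²)`, `γ₀ ≤ 1/16` (independent of `k`, `Λ_k`), and EVERY `ψ : Λ_k → ℝ^N`,
`γ₀(Σ_{⟨y,y′⟩⊂Λ_k}(Lᵏε)^{d−2}|U(Lᵏε Ā⁽ᵏ⁾(⟨y,y′⟩))ψ(y′) − ψ(y)|² + Σ_{y∈Λ_k}(Lᵏε)^d m²|ψ(y)|²) − 64γ₀d³e²(Lᵏδ)² Σ_{y∈Λ_k}(Lᵏε)^d|ψ(y)|²
≤ ⟨ψ, Δ^{(k),Lᵏε}(Bᵏ(Λ_k), Ã)ψ⟩ = termForm R C a Ã m² j ψ`. [cite: Balaban1982Higgs2, (3.29) p.590]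
[cite: Balaban1983RegularityDecay, Prop. 3.1′ of [2] (1.21)–(1.22) p.574] -/
theorem ineq329_regular_concrete (hK : K ≤ P.K) (ha : 0 < a) (hL : 1 < P.L) (hmsq : 0 ≤ msq)
    (A : HiggsLattice.VecField P 0) (j : Fin K) (hs : P.mesh (j.val + 1) ≤ 1) {δ : ℝ} (hδ : 0 ≤ δ)
    (hreg : ∀ z ∈ pieceF R j, ∀ μ' ν : Fin P.d, |A ⟨z.shift ν, μ'⟩ - A ⟨z, μ'⟩| ≤ δ)
    (hsmall : 8 * (P.d : ℝ) ^ 4 * (P.L : ℝ) ^ P.d * C.e ^ 2 * P.mesh (j.val + 1) ^ 2 *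
      ((P.L : ℝ) ^ (j.val + 1)) ^ 2 * δ ^ 2 ≤ 1 / 2)
    {γ₀ : ℝ} (hγ0 : 0 ≤ γ₀) (hγB : γ₀ * (8 * P.d + 2 * msq + 4) ≤ a * (1 - ((P.L : ℝ) ^ 2)⁻¹))
    (hγ16 : γ₀ ≤ 1 / 16) (ψ : LSite R j → V N) :
    γ₀ * ((∑ c : HiggsLattice.PBond P (j.val + 1), if Inside (R.block j) c then
            P.mesh (j.val + 1) ^ P.d * ‖covDeriv C (barA (j.val + 1) A) (extL R j ψ) c‖ ^ 2 else 0)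
          + massK R msq j ψ)
      - 64 * γ₀ * (P.d : ℝ) ^ 3 * C.e ^ 2 * ((P.L : ℝ) ^ (j.val + 1)) ^ 2 * δ ^ 2 *
          (∑ y : LSite R j, P.mesh (j.val + 1) ^ P.d * ‖ψ y‖ ^ 2)
      ≤ termForm R C a A msq j ψ :=
  le_ciInf fun v => sum329_le_pieceExp_regular R C hK ha hL hmsq A j hs hδ hreg hsmall hγ0 hγB hγ16 ψ v

/-- The same with the form written as `⟨ψ̃, Δ^{(k)}(Bᵏ(Λ_k), Ã)ψ̃⟩_{T⁽ᵏ⁾}` for the solved (I.2.21) operator of the tree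
(`B1Eq230FluctCov.deltaKA`, via `B2Eq328DeltaK.termForm_eq_deltaKA`; `m² > 0`). [cite: Balaban1982Higgs2, (3.29) p.590]
[cite: Balaban1982Higgs1, (2.21) p.610] -/
theorem ineq329_regular_deltaKA (hK : K ≤ P.K) (ha : 0 < a) (hL : 1 < P.L) (hmsq : 0 < msq)
    (A : HiggsLattice.VecField P 0) (j : Fin K) (hs : P.mesh (j.val + 1) ≤ 1) {δ : ℝ} (hδ : 0 ≤ δ)
    (hreg : ∀ z ∈ pieceF R j, ∀ μ' ν : Fin P.d, |A ⟨z.shift ν, μ'⟩ - A ⟨z, μ'⟩| ≤ δ)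
    (hsmall : 8 * (P.d : ℝ) ^ 4 * (P.L : ℝ) ^ P.d * C.e ^ 2 * P.mesh (j.val + 1) ^ 2 *
      ((P.L : ℝ) ^ (j.val + 1)) ^ 2 * δ ^ 2 ≤ 1 / 2)
    {γ₀ : ℝ} (hγ0 : 0 ≤ γ₀) (hγB : γ₀ * (8 * P.d + 2 * msq + 4) ≤ a * (1 - ((P.L : ℝ) ^ 2)⁻¹))
    (hγ16 : γ₀ ≤ 1 / 16) (ψ : LSite R j → V N) :
    γ₀ * ((∑ c : HiggsLattice.PBond P (j.val + 1), if Inside (R.block j) c then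
            P.mesh (j.val + 1) ^ P.d * ‖covDeriv C (barA (j.val + 1) A) (extL R j ψ) c‖ ^ 2 else 0)
          + massK R msq j ψ)
      - 64 * γ₀ * (P.d : ℝ) ^ 3 * C.e ^ 2 * ((P.L : ℝ) ^ (j.val + 1)) ^ 2 * δ ^ 2 *
          (∑ y : LSite R j, P.mesh (j.val + 1) ^ P.d * ‖ψ y‖ ^ 2)
      ≤ siteInner (extL R j ψ) (deltaKA C (pieceF R j) A msq a (j.val + 1) (extL R j ψ)) := by
  rw [← termForm_eq_deltaKA R C A ha hL hmsq j ψ]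
  exact ineq329_regular_concrete R C hK ha hL hmsq.le A j hs hδ hreg hsmall hγ0 hγB hγ16 ψ

/-- **A constant `γ₀` as printed** — *"dependent on the space dimension d and the constant a only, and independent of ε
and a choice of the sets"* (here also of the bound `m² ≤ O(1)` and of `L`): `γ₀ = min(a(1 − L⁻²)/(8d + 2m² + 4), 1/16)`
is positive and satisfies the three hypotheses of `ineq329_regular_concrete`. [cite: Balaban1982Higgs2, Prop. 3.1 p.589] -/
theorem gamma0_regular_spec (ha : 0 < a) (hL : 1 < P.L) (hmsq : 0 ≤ msq) :
    0 < min (a * (1 - ((P.L : ℝ) ^ 2)⁻¹) / (8 * P.d + 2 * msq + 4)) (1 / 16)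
      ∧ min (a * (1 - ((P.L : ℝ) ^ 2)⁻¹) / (8 * P.d + 2 * msq + 4)) (1 / 16) * (8 * P.d + 2 * msq + 4)
          ≤ a * (1 - ((P.L : ℝ) ^ 2)⁻¹)
      ∧ min (a * (1 - ((P.L : ℝ) ^ 2)⁻¹) / (8 * P.d + 2 * msq + 4)) (1 / 16) ≤ 1 / 16 := by
  have hL' : (1 : ℝ) < P.L := by exact_mod_cast hL
  have hd : (0 : ℝ) ≤ P.d := Nat.cast_nonneg _
  have hB0 : 0 < 8 * (P.d : ℝ) + 2 * msq + 4 := by linarith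
  have hainf0 : 0 < a * (1 - ((P.L : ℝ) ^ 2)⁻¹) := by
    have h1 : (1 : ℝ) < (P.L : ℝ) ^ 2 := by nlinarith
    have : ((P.L : ℝ) ^ 2)⁻¹ < 1 := inv_lt_one_of_one_lt₀ h1
    exact mul_pos ha (by linarith)
  refine ⟨lt_min (div_pos hainf0 hB0) (by norm_num), ?_, min_le_right _ _⟩
  calc min (a * (1 - ((P.L : ℝ) ^ 2)⁻¹) / (8 * P.d + 2 * msq + 4)) (1 / 16) * (8 * P.d + 2 * msq + 4)
      ≤ a * (1 - ((P.L : ℝ) ^ 2)⁻¹) / (8 * P.d + 2 * msq + 4) * (8 * P.d + 2 * msq + 4) :=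
        mul_le_mul_of_nonneg_right (min_le_left _ _) hB0.le
    _ = a * (1 - ((P.L : ℝ) ^ 2)⁻¹) := div_mul_cancel₀ _ hB0.ne'

end Ineq329

/-! ## §3 Proposition 3.1 (3.26) under restrictions on the configuration, on the concrete carrier -/

section Prop31

variable (R : Regions P K) (C : ChargeData N) {a msq : ℝ}

/-- **The printed reduction (3.26) ⇐ (3.27) + (3.28) + (3.29), for RESTRICTED configurations**: p15's
`B2Eq328ConcretePieces.prop31_concrete` with the per-scale inequalities (3.29) assumed only *"for φ′_k … satisfying
suitable restrictions"* `Good j (φ_{j+1}↾_{Λ_{j+1}})`, concluding (3.26) for the configurations `Φ` all of whose pieces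
satisfy them — via b2b's `B2.prop31_of_decoupling`. [cite: Balaban1982Higgs2, Prop. 3.1 (3.26) p.589, (3.29) p.590] -/
theorem prop31_restricted_concrete (A : HiggsLattice.VecField P 0) (hR : Nested R) (ha : 0 < a) (hL : 1 < P.L)
    (hmsq : 0 < msq) {γ₀ : ℝ} (hγ₁ : γ₀ ≤ 1) (bond mass : (j : Fin K) → (LSite R j → V N) → ℝ) (err : Fin K → ℝ)
    (Good : (j : Fin K) → (LSite R j → V N) → Prop)
    (h329 : ∀ (j : Fin K) (ψ : LSite R j → V N), Good j ψ →
      γ₀ * (bond j ψ + mass j ψ) - err j ≤ termForm R C a A msq j ψ)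
    (Φ : Cfg R N) (hΦ : ∀ j, Good j (resL R j Φ)) :
    γ₀ * (bond0 R C A Φ.1 + ∑ j, bond j (resL R j Φ)) + γ₀ * (mass0 R msq Φ.1 + ∑ j, mass j (resL R j Φ))
        - ∑ j, err j ≤ form325 R C a A msq Φ := by
  have h327 := ineq327_concrete R C hR.pieces A ha hL hmsq Φ
  have h328 := eq328_concrete R C A hR ha hL hmsq.le Φ
  have h0 : γ₀ * bond0 R C A Φ.1 + γ₀ * mass0 R msq Φ.1 ≤ outTerm R C A msq Φ.1 := by
    rw [outTerm_eq]
    have hb := bond0_nonneg R C A Φ.1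
    have hm := mass0_nonneg R hmsq.le Φ.1
    nlinarith
  have key := B2.prop31_of_decoupling K γ₀ (form325 R C a A msq Φ) (form325N R C a hR.pieces A msq Φ)
    (natExt (outTerm R C A msq Φ.1) fun j => termForm R C a A msq j (resL R j Φ))
    (natExt (bond0 R C A Φ.1) fun j => bond j (resL R j Φ))
    (natExt (mass0 R msq Φ.1) fun j => mass j (resL R j Φ))
    (natExt 0 err) h327 (by rw [sum_range_natExt]; exact h328) (by simpa using h0) (fun k hk1 hkK => by
      obtain ⟨j, rfl⟩ : ∃ j, k = j + 1 := ⟨k - 1, by omega⟩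
      have hj : j < K := by omega
      have e1 := natExt_succ (bond0 R C A Φ.1) (fun j => bond j (resL R j Φ)) ⟨j, hj⟩
      have e2 := natExt_succ (mass0 R msq Φ.1) (fun j => mass j (resL R j Φ)) ⟨j, hj⟩
      have e3 := natExt_succ (0 : ℝ) err ⟨j, hj⟩
      have e4 := natExt_succ (outTerm R C A msq Φ.1) (fun j => termForm R C a A msq j (resL R j Φ)) ⟨j, hj⟩
      simp only [] at e1 e2 e3 e4
      rw [e1, e2, e3, e4]
      exact h329 ⟨j, hj⟩ _ (hΦ ⟨j, hj⟩))
  rw [sum_range_natExt, sum_range_natExt, sum_Icc_natExt] at key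
  exact key

/-- Under the sup-restriction `|ψ(y)| ≤ Ψ` on `Λ_k`: `Σ_{y∈Λ_k}(Lᵏε)^d|ψ(y)|² ≤ Ψ²(Lᵏε)^d|Λ_k|` — the measure-of-the-set form
`O(·)|Λ_k|` of the printed error. [cite: Balaban1982Higgs2, (3.26) p.589, (3.29) p.590] -/
theorem l2_le_of_sup (j : Fin K) (ψ : LSite R j → V N) {Ψ : ℝ} (hΨ : ∀ y, ‖ψ y‖ ≤ Ψ) :
    ∑ y : LSite R j, P.mesh (j.val + 1) ^ P.d * ‖ψ y‖ ^ 2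
      ≤ Ψ ^ 2 * P.mesh (j.val + 1) ^ P.d * ((R.block j).card : ℝ) := by
  have hsd : 0 ≤ P.mesh (j.val + 1) ^ P.d := pow_nonneg (P.mesh_pos _).le _
  calc ∑ y : LSite R j, P.mesh (j.val + 1) ^ P.d * ‖ψ y‖ ^ 2
      ≤ ∑ _y : LSite R j, P.mesh (j.val + 1) ^ P.d * Ψ ^ 2 :=
        Finset.sum_le_sum fun y _ => mul_le_mul_of_nonneg_left
          (pow_le_pow_left₀ (norm_nonneg _) (hΨ y) 2) hsd
    _ = Ψ ^ 2 * P.mesh (j.val + 1) ^ P.d * ((R.block j).card : ℝ) := by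
        rw [Finset.sum_const, Finset.card_univ, nsmul_eq_mul, Fintype.card_coe]
        ring

/-- **PROPOSITION 3.1 (3.26), RESTRICTED (REGULAR NON-ZERO) FIELD, ON THE CONCRETE (3.23)/(3.24)/(3.25) CARRIER**: for nested
region data `R` (`K ≤` the number of scales, `Lᴷε ≤ 1`), `m² > 0`, `a > 0`, `L > 1`, a vector field `Ã` which is
`δ_k`-regular on each `Bᵏ(Λ_k)` ((1.21) in lattice units) with `8d⁴L^d e²(Lᵏε)²(Lᵏδ_k)² ≤ ½` (*"e sufficiently small"*),
`γ₀ ≥ 0` with `γ₀(8d + 2m² + 4) ≤ a(1 − L⁻²)`, `γ₀ ≤ 1/16`, and EVERY configuration `Φ` of (3.24) whose pieces obey the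
sup-restrictions `|φ_k(y)| ≤ Ψ_k` on `Λ_k` (*"satisfying the restrictions given by the characteristic functions in
(3.21)"*):
`γ₀(Σ_{k=0}^{K} bond_k(Ã)) + γ₀(Σ_{k=0}^{K} mass_k) − Σ_{k=1}^{K} 64γ₀d³e²(Lᵏδ_k)²Ψ_k²(Lᵏε)^d|Λ_k| ≤ ⟨Φ, Δ(Ã^ε)Φ⟩ = form325 R C a Ã m² Φ`
— the printed reduction `prop31_restricted_concrete` ((3.27) + (3.28) + the `k = 0` term) with its per-scale input (3.29)
DISCHARGED by `ineq329_regular_concrete`; the error has the printed shape `Σ_k O(·)|Λ_k|`. [cite: Balaban1982Higgs2, Prop. 3.1 (3.26) p.589] -/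
theorem prop31_regular_concrete (A : HiggsLattice.VecField P 0) (hR : Nested R) (hK : K ≤ P.K) (hε : P.mesh K ≤ 1)
    (ha : 0 < a) (hL : 1 < P.L) (hmsq : 0 < msq) {δ : Fin K → ℝ} (hδ : ∀ j, 0 ≤ δ j)
    (hreg : ∀ (j : Fin K), ∀ z ∈ pieceF R j, ∀ μ' ν : Fin P.d, |A ⟨z.shift ν, μ'⟩ - A ⟨z, μ'⟩| ≤ δ j)
    (hsmall : ∀ j : Fin K, 8 * (P.d : ℝ) ^ 4 * (P.L : ℝ) ^ P.d * C.e ^ 2 * P.mesh (j.val + 1) ^ 2 *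
      ((P.L : ℝ) ^ (j.val + 1)) ^ 2 * δ j ^ 2 ≤ 1 / 2)
    {γ₀ : ℝ} (hγ0 : 0 ≤ γ₀) (hγB : γ₀ * (8 * P.d + 2 * msq + 4) ≤ a * (1 - ((P.L : ℝ) ^ 2)⁻¹))
    (hγ16 : γ₀ ≤ 1 / 16) (Ψ : Fin K → ℝ) (Φ : Cfg R N) (hΦ : ∀ (j : Fin K) (y : LSite R j), ‖resL R j Φ y‖ ≤ Ψ j) :
    γ₀ * (bond0 R C A Φ.1 + ∑ j : Fin K, (∑ c : HiggsLattice.PBond P (j.val + 1), if Inside (R.block j) c then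
            P.mesh (j.val + 1) ^ P.d * ‖covDeriv C (barA (j.val + 1) A) (extL R j (resL R j Φ)) c‖ ^ 2 else 0))
        + γ₀ * (mass0 R msq Φ.1 + ∑ j : Fin K, massK R msq j (resL R j Φ))
        - ∑ j : Fin K, 64 * γ₀ * (P.d : ℝ) ^ 3 * C.e ^ 2 * ((P.L : ℝ) ^ (j.val + 1)) ^ 2 * δ j ^ 2 *
            (Ψ j ^ 2 * P.mesh (j.val + 1) ^ P.d * ((R.block j).card : ℝ))
      ≤ form325 R C a A msq Φ := by
  have hγ1 : γ₀ ≤ 1 := hγ16.trans (by norm_num)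
  refine prop31_restricted_concrete R C A hR ha hL hmsq hγ1
    (fun j ψ => ∑ c : HiggsLattice.PBond P (j.val + 1), if Inside (R.block j) c then
      P.mesh (j.val + 1) ^ P.d * ‖covDeriv C (barA (j.val + 1) A) (extL R j ψ) c‖ ^ 2 else 0)
    (fun j ψ => massK R msq j ψ)
    (fun j => 64 * γ₀ * (P.d : ℝ) ^ 3 * C.e ^ 2 * ((P.L : ℝ) ^ (j.val + 1)) ^ 2 * δ j ^ 2 *
      (Ψ j ^ 2 * P.mesh (j.val + 1) ^ P.d * ((R.block j).card : ℝ)))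
    (fun j ψ => ∀ y, ‖ψ y‖ ≤ Ψ j) (fun j ψ hψ => ?_) Φ hΦ
  have hs : P.mesh (j.val + 1) ≤ 1 := (mesh_le_mesh (Nat.succ_le_of_lt j.isLt)).trans hε
  have h := ineq329_regular_concrete R C hK ha hL hmsq.le A j hs (hδ j) (hreg j) (hsmall j) hγ0 hγB hγ16 ψ
  have hM := l2_le_of_sup R j ψ hψ
  have hc : 0 ≤ 64 * γ₀ * (P.d : ℝ) ^ 3 * C.e ^ 2 * ((P.L : ℝ) ^ (j.val + 1)) ^ 2 * δ j ^ 2 := by positivity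
  have := mul_le_mul_of_nonneg_left hM hc
  linarith

/-- **The same for the printed regions** `Λ_k = Λ₅⁽ᵏ⁻¹⁾′ ∩ Λ₅⁽ᵏ⁾ᶜ` built from a tower of large-field regions
(`B2Eq324NestedRegions.Tower`, whose `nested_regions` discharges `Nested`). [cite: Balaban1982Higgs2, Prop. 3.1 (3.26) p.589] -/
theorem prop31_regular_tower (T : Tower P K) (C : ChargeData N) (A : HiggsLattice.VecField P 0) (hK : K ≤ P.K)
    (hε : P.mesh K ≤ 1) (ha : 0 < a) (hL : 1 < P.L) (hmsq : 0 < msq) {δ : Fin K → ℝ} (hδ : ∀ j, 0 ≤ δ j)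
    (hreg : ∀ (j : Fin K), ∀ z ∈ pieceF T.regions j, ∀ μ' ν : Fin P.d, |A ⟨z.shift ν, μ'⟩ - A ⟨z, μ'⟩| ≤ δ j)
    (hsmall : ∀ j : Fin K, 8 * (P.d : ℝ) ^ 4 * (P.L : ℝ) ^ P.d * C.e ^ 2 * P.mesh (j.val + 1) ^ 2 *
      ((P.L : ℝ) ^ (j.val + 1)) ^ 2 * δ j ^ 2 ≤ 1 / 2)
    {γ₀ : ℝ} (hγ0 : 0 ≤ γ₀) (hγB : γ₀ * (8 * P.d + 2 * msq + 4) ≤ a * (1 - ((P.L : ℝ) ^ 2)⁻¹))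
    (hγ16 : γ₀ ≤ 1 / 16) (Ψ : Fin K → ℝ) (Φ : Cfg T.regions N)
    (hΦ : ∀ (j : Fin K) (y : LSite T.regions j), ‖resL T.regions j Φ y‖ ≤ Ψ j) :
    γ₀ * (bond0 T.regions C A Φ.1 + ∑ j : Fin K, (∑ c : HiggsLattice.PBond P (j.val + 1),
          if Inside (T.regions.block j) c then P.mesh (j.val + 1) ^ P.d *
            ‖covDeriv C (barA (j.val + 1) A) (extL T.regions j (resL T.regions j Φ)) c‖ ^ 2 else 0))
        + γ₀ * (mass0 T.regions msq Φ.1 + ∑ j : Fin K, massK T.regions msq j (resL T.regions j Φ))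
        - ∑ j : Fin K, 64 * γ₀ * (P.d : ℝ) ^ 3 * C.e ^ 2 * ((P.L : ℝ) ^ (j.val + 1)) ^ 2 * δ j ^ 2 *
            (Ψ j ^ 2 * P.mesh (j.val + 1) ^ P.d * ((T.regions.block j).card : ℝ))
      ≤ form325 T.regions C a A msq Φ :=
  prop31_regular_concrete T.regions C A T.nested_regions hK hε ha hL hmsq hδ hreg hsmall hγ0 hγB hγ16 Ψ Φ hΦ

end Prop31

end Literature.MathematicalPhysics.QuantumFieldTheory.Balaban1983to89.B2Ineq329RegularField
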